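import Summits.QuantumFields.BalabanUV.Beta.KernelWardResidual
import Summits.QuantumFields.BalabanUV.Beta.GAN24.Lin4LegDivergence
import Summits.QuantumFields.BalabanUV.Beta.GAN24.StencilSlotLamDrift
import Summits.QuantumFields.BalabanUV.Beta.GAN24.BlockDivergenceFlux

/-!
# `BalabanUV.Beta.GAN24.GaugeReadLabelSums` — binder row G-an2-4 / (CONV-C), CT-W route of record «WC-TL», located crux (Q-R), RULING-preview
# R-gan24p1-g25-1 «QR-LL» (`HOME/b2b-balaban-gan24-p1/gen25/QR-DESIGN-v0.md` §2 (P2), §5 Q3 / K-LL-2):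
# **THE RESPONSE PIECE OF THE WARD RESIDUAL, SUMMED OVER LABELS — linear in the gauge weight, bi-localised with the SINGLE-LABEL constant for EVERY
# finite label set, and exponentially small when the weight lives far from the kernel's centre**
# (G-an2-4 formalisation swarm, unit `b2b-balaban-gan24-formalise-leaf-06`, gen 44; INTENT journal 2026-08-22T03:45Z).

NOT IN PRINT; OUR BOOKKEEPING ([folklore] `tsum`/finite-sum bookkeeping and one triangle inequality over an1's `KernelWardResidual` §1–§2, whose four
lemmas are the single-label instances `g := gaugeWt N y` of §1–§2 below and are NOT restated; leaf-03's `Lin4LegDivergence.tsum_mul_gaugeWt_eq_boxSum`,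
`BlockDivergenceFlux.boxSum_sub_shift_eq_faces` and the road's `StencilSlotLamDrift.onLat_weight_bound / onLat_biLoc` consumed BY NAME).
HONEST FRAMING (cell contract, verbatim): «discharging `BetaPertH` makes Bałaban's UV
stability UNCONDITIONAL — a real constructive-QFT result; it is NOT the continuum limit and NOT the Clay problem.»  HONEST DEPENDENCY (verbatim): «continuum YM on T⁴ ⇐
BetaPertH ∧ nine spine estimates (0/9 proved); BetaPertH ⇐ (D1) ∧ (D4) ∧ CAP+tail; G-an2-4 gates asym, D1 and NE2/3/4.»  No cited fact, no `def`, no `def … : Prop`,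
0 sorry; instantiates NO binder of the β-function wall.

WHAT.  an1's direct residual of the Ward kernel law (`WardLocusRecursiveStep.divW_WrecAt_of_tableLaws`, `KernelWardResidual.loc_residual`) carries the RESPONSE PIECE
`𝒢[A](ĝ) := Σ_κ wsum (u ↦ Σ'_{x₂} Σ_{κ₂} A u x₂ (inl κ) (inl κ₂)·ĝ κ₂ x₂) (S κ) + Σ_ρ cwsum N (w ↦ Σ'_{x₂} Σ_{κ₂} A (N•w) x₂ (inr ρ) (inl κ₂)·ĝ κ₂ x₂) (M ρ)` of the
response kernel `A = G ∘ dM G N S M ν y′` paired with the block gauge weight `ĝ = gaugeWt N y` (= `∇1_{B(y)}`).  The OWNER gan24-p1 g25's design §2 collapses the label: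
for a finite set `T` of labels the partial sum `Ψ_j^T` wants `Σ_{y∈T} 𝒢[A](ĝ_y) = 𝒢[A](ĝ_T)` with the UNION WEIGHT `ĝ_T := Σ_{y∈T} gaugeWt N y` (= `∇1_{T-fine}`, road-P2's
`WardResidualLabelSums.sum_gaugeWt`), and §5 Q3 asks whether the class of `𝒢[A](ĝ_T)` is governed by `sup |ĝ_T|` (= 1) or by its mass (∝ |∂(T-fine)|) — kill-test K-LL-2.
* §1 GENERAL WEIGHTS `g` with `|g κ x| ≤ 1`: `abs_read_term_le`, `summable_read`, **`abs_read_le`** — the gauge read of a kernel bi-localised at `(p, q)` decays from `p`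
  with an1's constant `(d+1)·C·Zl δ` VERBATIM, whatever the weight; **`abs_read_le_of_support`** — if the weight vanishes within l1-distance `D` of `q`, the SAME bound
  × `e^{−(δ/2)·D}` (constant `(d+1)·C·Zl(δ/2)`): the LAYER ENVELOPE of design §3 (LAY)(b) for the response letter, with the consumer's choice of `D`.
* §2 SUPERPOSITIONS: **`biLoc_sup_of_weight`** (an1's `biLoc_gaugeSup` for any weight of sup ≤ 1, same constant, rate `δ/2`), **`biLoc_sup_of_support`** (× `e^{−(δ/2)·D}`).
* §3 THE UNION WEIGHT: **`abs_sum_gaugeWt_le_one`** (`|ĝ_T κ x| ≤ 1` for EVERY finset `T`), `sum_gaugeWt_ne_zero` (`ĝ_T` lives on the bonds crossing `∂(T-fine)`),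
  `summable_sum_mul_gaugeWt` (single label: finitely supported terms, `1 ≤ N`).
* §4 THE LABEL SUMS: **`sum_read_gaugeWt`** (`Σ_{y∈T}` of the single-label reads = the read with `ĝ_T`, any scalar family, `1 ≤ N`), `sum_read_gaugeWt_eq_boxSum` ∕
  **`sum_read_gaugeWt_eq_faceSum`** (closed block form ∕ UNSUMMED FACE-DIFFERENCE form, leaf-03's `tsum_mul_gaugeWt_eq_boxSum` ∕ `boxSum_sub_shift_eq_faces` BY NAME),
  `wsum_finset_sum_weight` / `cwsum_finset_sum_weight` (superpositions are finitely additive in the WEIGHT under termwise summability), and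
  **`sum_gaugeSup`**: `Σ_{y∈T} 𝒢[A](ĝ_y) = 𝒢[A](ĝ_T)` in an1's literal `wsum`/`cwsum` shape — the response summand of design §2 (P2) `Ψ_j^T`.
* §5 **`biLoc_gaugeSup_sum`**: `𝒢[A](ĝ_T)` is `BiLoc` at `(p, p)` with THE SINGLE-LABEL CONSTANT of `KernelWardResidual.biLoc_gaugeSup`, for every finset `T` — Q3 answered
  at the typed level: **K-LL-2 does not fire**; `biLoc_gaugeSup_sum_of_support`: × `e^{−(δ/2)·D}` when the crossing bonds of `∂(T-fine)` lie at l1-distance ≥ `D` from `q`.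
NOT here: the comb/wall instance `G_j = coDressKBmAt ρ Lc (KInvStep Lc j)` (ten lines in the consumer, as `KernelWardResidual.loc_residual_coDressKBmAt_KInvStep`), the other two
summands of `Ψ_j^T` (road-P2 `WardResidualLabelSums` §4–§5), any `dist`/`LayerStencil` predicate, any (LT) estimate.  Asserts NO estimate of Bałaban's; decides nothing about
(Q-R) / (Q-L) / (C); NOTHING of «T2Shape» / «T2Drift» / (hW, hWall) discharged; NEVER «G-an2-4 closed» as (CONV-C); NOT D1, NOT BetaPertH, NOT continuum, NOT Clay. Unit
`b2b-balaban-gan24-formalise-leaf-06` (gen 44), 2026-08-22; no existing file touched.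
-/

noncomputable section

open Finset
open scoped BigOperators
open Literature.MathematicalPhysics.QuantumFieldTheory
open Literature.MathematicalPhysics.QuantumFieldTheory.Balaban1983to89
open Literature.MathematicalPhysics.QuantumFieldTheory.Balaban1983to89.Beta
open Literature.Probability.LatticeModels (Torus.proj)
open B12Sec2to5 (l1 l1_nonneg)
open B6BondElimination (unitVec)
open ExpKernelCalculus (MKer Decays BiLoc VertexFamily comp Zl Zl_nonneg summable_exp_shift' tsum_exp_shift')
open KernelWard (biLoc_add biLoc_finset_sum)
open AffineAveraging (Site box toSite)
open AveragingContours (blk)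
open OneStepResolventKernel (Fib wsum LocStencil biLoc_mono biLoc_wsum summable_wsumTerm)
open InterLevelTransport (cwsum onLat onLat_off biLoc_cwsum)
open Summit.QuantumFields.BalabanUV.Beta.TameKernelCalculus
open Summit.QuantumFields.BalabanUV.Beta.KernelWardRelative (gaugeWt summable_blockInd_mul)
open Summit.QuantumFields.BalabanUV.Beta.GAN24.Lin4LegDivergence (tsum_mul_gaugeWt_eq_boxSum)
open Summit.QuantumFields.BalabanUV.Beta.GAN24.BlockDivergenceFlux (boxSum_sub_shift_eq_faces)
open Summit.QuantumFields.BalabanUV.Beta.GAN24.StencilSlotLamDrift (onLat_weight_bound onLat_biLoc)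

namespace Summit.QuantumFields.BalabanUV.Beta.GAN24.GaugeReadLabelSums

variable {d : ℕ}

/-! ## §1 The gauge read of a bi-localised kernel against ANY weight of sup ≤ 1 -/
section Read

variable {A : MKer (d + 1) (Fib d)} {p q : Site (d + 1)} {C δ : ℝ} {g : Fin (d + 1) → Site (d + 1) → ℝ}

/-- [folklore] One fine column of the read of `A` against a weight of sup ≤ 1: `|Σ_{κ₂} A u x₂ a (inl κ₂)·g κ₂ x₂| ≤ (d+1)·C·e^{−δ|u−p|₁}·e^{−δ|x₂−q|₁}` for `A`
bi-localised at `(p, q)` (an1's `abs_gaugeRead_term_le` is the instance `g := gaugeWt N y`). -/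
theorem abs_read_term_le (hA : BiLoc A p q C δ) (hg : ∀ κ x, |g κ x| ≤ 1) (u x₂ : Site (d + 1)) (a : Fib d) :
    |∑ κ₂, A u x₂ a (Sum.inl κ₂) * g κ₂ x₂| ≤
      ((d + 1 : ℕ) * C * Real.exp (-δ * l1 (u - p))) * Real.exp (-δ * l1 (x₂ - q)) := by
  calc |∑ κ₂, A u x₂ a (Sum.inl κ₂) * g κ₂ x₂| ≤ ∑ κ₂, |A u x₂ a (Sum.inl κ₂) * g κ₂ x₂| := Finset.abs_sum_le_sum_abs _ _
    _ ≤ ∑ _κ₂ : Fin (d + 1), C * Real.exp (-δ * (l1 (u - p) + l1 (x₂ - q))) := Finset.sum_le_sum fun κ₂ _ => by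
        rw [abs_mul]
        calc |A u x₂ a (Sum.inl κ₂)| * |g κ₂ x₂| ≤ |A u x₂ a (Sum.inl κ₂)| * 1 :=
              mul_le_mul_of_nonneg_left (hg κ₂ x₂) (abs_nonneg _)
          _ ≤ C * Real.exp (-δ * (l1 (u - p) + l1 (x₂ - q))) := by rw [mul_one]; exact hA u x₂ a (Sum.inl κ₂)
    _ = ((d + 1 : ℕ) * C * Real.exp (-δ * l1 (u - p))) * Real.exp (-δ * l1 (x₂ - q)) := by
        rw [Finset.sum_const, Finset.card_univ, Fintype.card_fin, nsmul_eq_mul, mul_add, Real.exp_add]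
        ring

/-- [folklore] The read of a bi-localised kernel against a weight of sup ≤ 1 is summable in the fine position `x₂`. -/
theorem summable_read (hA : BiLoc A p q C δ) (hδ : 0 < δ) (hg : ∀ κ x, |g κ x| ≤ 1) (u : Site (d + 1)) (a : Fib d) :
    Summable fun x₂ => ∑ κ₂, A u x₂ a (Sum.inl κ₂) * g κ₂ x₂ :=
  Summable.of_norm_bounded ((summable_exp_shift' hδ q).mul_left _)
    (fun x₂ => by rw [Real.norm_eq_abs]; exact abs_read_term_le hA hg u x₂ a)

/-- [folklore] **THE READ OF A BI-LOCALISED KERNEL AGAINST ANY WEIGHT OF SUP ≤ 1 DECAYS FROM ITS LEFT CENTRE WITH an1's CONSTANT**: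
`|Σ'_{x₂} Σ_{κ₂} A u x₂ a (inl κ₂)·g κ₂ x₂| ≤ (d+1)·C·Zl δ·e^{−δ|u−p|₁}` — the constant of `KernelWardResidual.abs_gaugeRead_le` VERBATIM, for every `g` with `|g| ≤ 1`
(only the sup of the weight enters, never its mass). -/
theorem abs_read_le (hA : BiLoc A p q C δ) (hδ : 0 < δ) (hg : ∀ κ x, |g κ x| ≤ 1) (u : Site (d + 1)) (a : Fib d) :
    |∑' x₂, ∑ κ₂, A u x₂ a (Sum.inl κ₂) * g κ₂ x₂| ≤ ((d + 1 : ℕ) * C * Zl (d + 1) δ) * Real.exp (-δ * l1 (u - p)) := by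
  have hs := summable_read hA hδ hg u a
  calc |∑' x₂, ∑ κ₂, A u x₂ a (Sum.inl κ₂) * g κ₂ x₂| ≤ ∑' x₂, |∑ κ₂, A u x₂ a (Sum.inl κ₂) * g κ₂ x₂| := by
        have h := norm_tsum_le_tsum_norm hs.norm
        simpa only [Real.norm_eq_abs] using h
    _ ≤ ∑' x₂, ((d + 1 : ℕ) * C * Real.exp (-δ * l1 (u - p))) * Real.exp (-δ * l1 (x₂ - q)) :=
        Summable.tsum_le_tsum (fun x₂ => abs_read_term_le hA hg u x₂ a) hs.abs ((summable_exp_shift' hδ q).mul_left _)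
    _ = ((d + 1 : ℕ) * C * Zl (d + 1) δ) * Real.exp (-δ * l1 (u - p)) := by
        rw [tsum_mul_left, tsum_exp_shift']
        ring

/-- [folklore] One fine column under a SUPPORT hypothesis: if the weight vanishes at every `x₂` with `|x₂ − q|₁ < D` (i.e. `g κ₂ x₂ ≠ 0 → D ≤ |x₂ − q|₁`), then
`|Σ_{κ₂} A u x₂ a (inl κ₂)·g κ₂ x₂| ≤ (d+1)·C·e^{−δ|u−p|₁}·e^{−(δ/2)·D}·e^{−(δ/2)|x₂−q|₁}` (half of the rate pays the envelope, half stays summable). -/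
theorem abs_read_term_le_of_support (hA : BiLoc A p q C δ) (hδ : 0 ≤ δ) (hg : ∀ κ x, |g κ x| ≤ 1) {D : ℝ}
    (hD : ∀ κ x, g κ x ≠ 0 → D ≤ l1 (x - q)) (u x₂ : Site (d + 1)) (a : Fib d) :
    |∑ κ₂, A u x₂ a (Sum.inl κ₂) * g κ₂ x₂| ≤
      ((d + 1 : ℕ) * C * Real.exp (-δ * l1 (u - p)) * Real.exp (-(δ / 2) * D)) * Real.exp (-(δ / 2) * l1 (x₂ - q)) := by
  have hC : 0 ≤ C := hA.nonneg (Sum.inl 0)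
  by_cases h : ∃ κ, g κ x₂ ≠ 0
  · obtain ⟨κ, hκ⟩ := h
    have hDx : D ≤ l1 (x₂ - q) := hD κ x₂ hκ
    have h2 : Real.exp (-δ * l1 (x₂ - q)) ≤ Real.exp (-(δ / 2) * D) * Real.exp (-(δ / 2) * l1 (x₂ - q)) := by
      rw [← Real.exp_add]
      exact Real.exp_le_exp.2 (by nlinarith [mul_nonneg hδ (sub_nonneg.2 hDx)])
    calc |∑ κ₂, A u x₂ a (Sum.inl κ₂) * g κ₂ x₂|
        ≤ ((d + 1 : ℕ) * C * Real.exp (-δ * l1 (u - p))) * Real.exp (-δ * l1 (x₂ - q)) := abs_read_term_le hA hg u x₂ a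
      _ ≤ ((d + 1 : ℕ) * C * Real.exp (-δ * l1 (u - p))) * (Real.exp (-(δ / 2) * D) * Real.exp (-(δ / 2) * l1 (x₂ - q))) :=
          mul_le_mul_of_nonneg_left h2 (by positivity)
      _ = ((d + 1 : ℕ) * C * Real.exp (-δ * l1 (u - p)) * Real.exp (-(δ / 2) * D)) * Real.exp (-(δ / 2) * l1 (x₂ - q)) := by ring
  · push Not at h
    have h0 : ∑ κ₂, A u x₂ a (Sum.inl κ₂) * g κ₂ x₂ = 0 := Finset.sum_eq_zero fun κ₂ _ => by rw [h κ₂, mul_zero]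
    rw [h0, abs_zero]
    positivity

/-- [folklore] **THE LAYER ENVELOPE OF THE READ**: for `A` bi-localised at `(p, q)` (rate `δ > 0`) and a weight of sup ≤ 1 VANISHING WITHIN l1-DISTANCE `D` OF `q`,
`|Σ'_{x₂} Σ_{κ₂} A u x₂ a (inl κ₂)·g κ₂ x₂| ≤ (d+1)·C·Zl(δ/2)·e^{−(δ/2)·D}·e^{−δ|u−p|₁}` — the response letter is exponentially small in the distance from the kernel's
centre to the support of the weight (design §3 (LAY)(b) «`𝒢(∇1_B)` by `biLoc_gaugeSup`», with the consumer's `D`; no `dist` is defined here). -/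
theorem abs_read_le_of_support (hA : BiLoc A p q C δ) (hδ : 0 < δ) (hg : ∀ κ x, |g κ x| ≤ 1) {D : ℝ}
    (hD : ∀ κ x, g κ x ≠ 0 → D ≤ l1 (x - q)) (u : Site (d + 1)) (a : Fib d) :
    |∑' x₂, ∑ κ₂, A u x₂ a (Sum.inl κ₂) * g κ₂ x₂| ≤
      ((d + 1 : ℕ) * C * Zl (d + 1) (δ / 2) * Real.exp (-(δ / 2) * D)) * Real.exp (-δ * l1 (u - p)) := by
  have hs := summable_read hA hδ hg u a
  have hδ2 : 0 < δ / 2 := half_pos hδ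
  calc |∑' x₂, ∑ κ₂, A u x₂ a (Sum.inl κ₂) * g κ₂ x₂| ≤ ∑' x₂, |∑ κ₂, A u x₂ a (Sum.inl κ₂) * g κ₂ x₂| := by
        have h := norm_tsum_le_tsum_norm hs.norm
        simpa only [Real.norm_eq_abs] using h
    _ ≤ ∑' x₂, ((d + 1 : ℕ) * C * Real.exp (-δ * l1 (u - p)) * Real.exp (-(δ / 2) * D)) * Real.exp (-(δ / 2) * l1 (x₂ - q)) :=
        Summable.tsum_le_tsum (fun x₂ => abs_read_term_le_of_support hA hδ.le hg hD u x₂ a) hs.abs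
          ((summable_exp_shift' hδ2 q).mul_left _)
    _ = ((d + 1 : ℕ) * C * Zl (d + 1) (δ / 2) * Real.exp (-(δ / 2) * D)) * Real.exp (-δ * l1 (u - p)) := by
        rw [tsum_mul_left, tsum_exp_shift']
        ring

end Read

/-! ## §2 The first-order superposition with read weights, any weight of sup ≤ 1 -/
section Sup

variable {N : ℕ} [NeZero N]

/-- [folklore] **`𝒢[A](g)` IS BI-LOCALISED FOR ANY WEIGHT OF SUP ≤ 1, WITH an1's CONSTANT** — `KernelWardResidual.biLoc_gaugeSup` with `gaugeWt N y` replaced by an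
arbitrary `g`, `|g κ x| ≤ 1`: for `A` bi-localised at `(p, q)` and localised tables `S` (`LocStencil S Cs δ`), `M` (`VertexFamily M N CM δ`), the superposition
`Σ_κ wsum (u ↦ Σ'Σ A u x₂ (inl κ)(inl κ₂)·g κ₂ x₂) (S κ) + Σ_ρ cwsum N (w ↦ Σ'Σ A (N•w) x₂ (inr ρ)(inl κ₂)·g κ₂ x₂) (M ρ)` is bi-localised at `(p, p)`, rate `δ/2`,
constant as displayed (identical to an1's). -/
theorem biLoc_sup_of_weight {A : MKer (d + 1) (Fib d)} {p q : Site (d + 1)} {C δ : ℝ} (hA : BiLoc A p q C δ) (hδ : 0 < δ)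
    {g : Fin (d + 1) → Site (d + 1) → ℝ} (hg : ∀ κ x, |g κ x| ≤ 1)
    {S : Fin (d + 1) → Site (d + 1) → MKer (d + 1) (Fib d)} {Cs : ℝ} (hS : LocStencil S Cs δ)
    {M : Fin (d + 1) → Site (d + 1) → MKer (d + 1) (Fib d)} {CM : ℝ} (hM : VertexFamily M N CM δ) :
    BiLoc (∑ κ, wsum (fun u => ∑' x₂, ∑ κ₂, A u x₂ (Sum.inl κ) (Sum.inl κ₂) * g κ₂ x₂) (S κ)
        + ∑ ρ, cwsum N (fun w => ∑' x₂, ∑ κ₂, A ((N : ℤ) • w) x₂ (Sum.inr ρ) (Sum.inl κ₂) * g κ₂ x₂) (M ρ)) p p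
      ((d + 1 : ℕ) * ((d + 1 : ℕ) * C * Zl (d + 1) δ * Cs * Zl (d + 1) (δ / 2))
        + (d + 1 : ℕ) * ((d + 1 : ℕ) * C * Zl (d + 1) δ * CM * Zl (d + 1) (δ / 2))) (δ / 2) := by
  have hC : 0 ≤ C := hA.nonneg (Sum.inl 0)
  have hC' : 0 ≤ (d + 1 : ℕ) * C * Zl (d + 1) δ := by
    have := Zl_nonneg (D := d + 1) hδ
    positivity
  have h1 : ∀ κ : Fin (d + 1), BiLoc (wsum (fun u => ∑' x₂, ∑ κ₂, A u x₂ (Sum.inl κ) (Sum.inl κ₂) * g κ₂ x₂) (S κ)) p p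
      ((d + 1 : ℕ) * C * Zl (d + 1) δ * Cs * Zl (d + 1) (δ / 2)) (δ / 2) := fun κ =>
    biLoc_wsum (fun u => abs_read_le hA hδ hg u (Sum.inl κ)) (fun u => hS κ u) hδ hC'
  have h2 : ∀ ρ : Fin (d + 1), BiLoc (cwsum N (fun w => ∑' x₂, ∑ κ₂, A ((N : ℤ) • w) x₂ (Sum.inr ρ) (Sum.inl κ₂) * g κ₂ x₂) (M ρ)) p p
      ((d + 1 : ℕ) * C * Zl (d + 1) δ * CM * Zl (d + 1) (δ / 2)) (δ / 2) := fun ρ =>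
    biLoc_cwsum (fun w => abs_read_le hA hδ hg ((N : ℤ) • w) (Sum.inr ρ)) (fun w => hM ρ w) hδ hC'
  have hs1 := biLoc_finset_sum Finset.univ (fun κ _ => h1 κ)
  have hs2 := biLoc_finset_sum Finset.univ (fun ρ _ => h2 ρ)
  simp only [Finset.sum_const, Finset.card_univ, Fintype.card_fin, nsmul_eq_mul] at hs1 hs2
  exact biLoc_add hs1 hs2

/-- [folklore] **`𝒢[A](g)` UNDER A SUPPORT HYPOTHESIS** — the same superposition, for a weight of sup ≤ 1 vanishing within l1-distance `D` of `q`, is bi-localised at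
`(p, p)` with the constant of `biLoc_sup_of_weight` at `Zl(δ/2)` TIMES `e^{−(δ/2)·D}` (rate `δ/2`). -/
theorem biLoc_sup_of_support {A : MKer (d + 1) (Fib d)} {p q : Site (d + 1)} {C δ : ℝ} (hA : BiLoc A p q C δ) (hδ : 0 < δ)
    {g : Fin (d + 1) → Site (d + 1) → ℝ} (hg : ∀ κ x, |g κ x| ≤ 1) {D : ℝ} (hD : ∀ κ x, g κ x ≠ 0 → D ≤ l1 (x - q))
    {S : Fin (d + 1) → Site (d + 1) → MKer (d + 1) (Fib d)} {Cs : ℝ} (hS : LocStencil S Cs δ)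
    {M : Fin (d + 1) → Site (d + 1) → MKer (d + 1) (Fib d)} {CM : ℝ} (hM : VertexFamily M N CM δ) :
    BiLoc (∑ κ, wsum (fun u => ∑' x₂, ∑ κ₂, A u x₂ (Sum.inl κ) (Sum.inl κ₂) * g κ₂ x₂) (S κ)
        + ∑ ρ, cwsum N (fun w => ∑' x₂, ∑ κ₂, A ((N : ℤ) • w) x₂ (Sum.inr ρ) (Sum.inl κ₂) * g κ₂ x₂) (M ρ)) p p
      ((d + 1 : ℕ) * ((d + 1 : ℕ) * C * Zl (d + 1) (δ / 2) * Real.exp (-(δ / 2) * D) * Cs * Zl (d + 1) (δ / 2))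
        + (d + 1 : ℕ) * ((d + 1 : ℕ) * C * Zl (d + 1) (δ / 2) * Real.exp (-(δ / 2) * D) * CM * Zl (d + 1) (δ / 2))) (δ / 2) := by
  have hC : 0 ≤ C := hA.nonneg (Sum.inl 0)
  have hC' : 0 ≤ (d + 1 : ℕ) * C * Zl (d + 1) (δ / 2) * Real.exp (-(δ / 2) * D) := by
    have := Zl_nonneg (D := d + 1) (half_pos hδ)
    positivity
  have h1 : ∀ κ : Fin (d + 1), BiLoc (wsum (fun u => ∑' x₂, ∑ κ₂, A u x₂ (Sum.inl κ) (Sum.inl κ₂) * g κ₂ x₂) (S κ)) p p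
      ((d + 1 : ℕ) * C * Zl (d + 1) (δ / 2) * Real.exp (-(δ / 2) * D) * Cs * Zl (d + 1) (δ / 2)) (δ / 2) := fun κ =>
    biLoc_wsum (fun u => abs_read_le_of_support hA hδ hg hD u (Sum.inl κ)) (fun u => hS κ u) hδ hC'
  have h2 : ∀ ρ : Fin (d + 1), BiLoc (cwsum N (fun w => ∑' x₂, ∑ κ₂, A ((N : ℤ) • w) x₂ (Sum.inr ρ) (Sum.inl κ₂) * g κ₂ x₂) (M ρ)) p p
      ((d + 1 : ℕ) * C * Zl (d + 1) (δ / 2) * Real.exp (-(δ / 2) * D) * CM * Zl (d + 1) (δ / 2)) (δ / 2) := fun ρ =>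
    biLoc_cwsum (fun w => abs_read_le_of_support hA hδ hg hD ((N : ℤ) • w) (Sum.inr ρ)) (fun w => hM ρ w) hδ hC'
  have hs1 := biLoc_finset_sum Finset.univ (fun κ _ => h1 κ)
  have hs2 := biLoc_finset_sum Finset.univ (fun ρ _ => h2 ρ)
  simp only [Finset.sum_const, Finset.card_univ, Fintype.card_fin, nsmul_eq_mul] at hs1 hs2
  exact biLoc_add hs1 hs2

end Sup

/-! ## §3 The union weight `ĝ_T := Σ_{y∈T} gaugeWt N y` has sup ≤ 1 and lives on the bonds crossing `∂(T-fine)` -/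
section LabelSums

variable {N : ℕ}

/-- [folklore] **THE UNION WEIGHT HAS SUP ≤ 1, FOR EVERY FINITE LABEL SET**: `|Σ_{y∈T} gaugeWt N y κ x| ≤ 1` — the sum is the difference of the two indicators
`1_T (blk N (x + e_κ))`, `1_T (blk N x)` (road-P2's `WardResidualLabelSums.sum_gaugeWt` is the identity; only the bound is recorded here). -/
theorem abs_sum_gaugeWt_le_one (T : Finset (Site (d + 1))) (N : ℕ) (κ : Fin (d + 1)) (x : Site (d + 1)) :
    |∑ y ∈ T, gaugeWt N y κ x| ≤ 1 := by
  classical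
  simp only [KernelWardRelative.gaugeWt, Finset.sum_sub_distrib, Finset.sum_ite_eq]
  split_ifs <;> norm_num

/-- [folklore] **THE UNION WEIGHT LIVES ON THE BONDS CROSSING `∂(T-fine)`**: if `Σ_{y∈T} gaugeWt N y κ x ≠ 0` then exactly one endpoint block of the bond `(x, x + e_κ)`
carries a label of `T`. -/
theorem sum_gaugeWt_ne_zero {T : Finset (Site (d + 1))} {N : ℕ} {κ : Fin (d + 1)} {x : Site (d + 1)} (h : ∑ y ∈ T, gaugeWt N y κ x ≠ 0) :
    (blk N (x + unitVec κ) ∈ T ↔ blk N x ∉ T) := by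
  classical
  simp only [KernelWardRelative.gaugeWt, Finset.sum_sub_distrib, Finset.sum_ite_eq] at h
  by_cases h1 : blk N (x + unitVec κ) ∈ T <;> by_cases h2 : blk N x ∈ T <;> simp_all

/-- [folklore] A single-label gauge pairing of any scalar family is summable (the terms are finitely supported: `KernelWardRelative.summable_blockInd_mul`, `1 ≤ N`). -/
theorem summable_sum_mul_gaugeWt (hN : 1 ≤ N) (g : Fin (d + 1) → Site (d + 1) → ℝ) (y : Site (d + 1)) :
    Summable fun u => ∑ κ, g κ u * gaugeWt N y κ u := by
  refine summable_sum fun κ _ => ?_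
  have hs1 := summable_blockInd_mul hN y (unitVec κ) (g κ)
  have hs2 : Summable fun u => (if blk N u = y then (1 : ℝ) else 0) * g κ u := by
    simpa only [add_zero] using summable_blockInd_mul hN y 0 (g κ)
  have e : (fun u => g κ u * gaugeWt N y κ u) =
      fun u => (if blk N (u + unitVec κ) = y then (1 : ℝ) else 0) * g κ u - (if blk N u = y then (1 : ℝ) else 0) * g κ u := by
    funext u
    simp only [KernelWardRelative.gaugeWt]
    ring
  rw [e]
  exact hs1.sub hs2


/-! ## §4 The label sums: the reads and the superpositions are additive in the weight -/


/-- [folklore] **THE SINGLE-LABEL READS ADD UP TO THE READ WITH THE UNION WEIGHT** (any scalar family `g`, `1 ≤ N`, every finset `T`):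
`Σ_{y∈T} Σ'_{x₂} Σ_{κ₂} g κ₂ x₂·gaugeWt N y κ₂ x₂ = Σ'_{x₂} Σ_{κ₂} g κ₂ x₂·(Σ_{y∈T} gaugeWt N y κ₂ x₂)` (`Summable.tsum_finsetSum` on finitely supported terms). -/
theorem sum_read_gaugeWt (hN : 1 ≤ N) (g : Fin (d + 1) → Site (d + 1) → ℝ) (T : Finset (Site (d + 1))) :
    ∑ y ∈ T, ∑' x₂, ∑ κ₂, g κ₂ x₂ * gaugeWt N y κ₂ x₂ = ∑' x₂, ∑ κ₂, g κ₂ x₂ * ∑ y ∈ T, gaugeWt N y κ₂ x₂ := by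
  rw [← Summable.tsum_finsetSum (fun y _ => summable_sum_mul_gaugeWt hN g y)]
  refine tsum_congr fun x₂ => ?_
  rw [Finset.sum_comm]
  exact Finset.sum_congr rfl fun κ₂ _ => by rw [Finset.mul_sum]

/-- [folklore] … and in CLOSED BLOCK FORM (leaf-03's `Lin4LegDivergence.tsum_mul_gaugeWt_eq_boxSum` BY NAME, label by label): the read with the union weight is the sum
over the labels of `T` of the block sums of the fine backward differences of `g`,
`Σ'_{x₂} Σ_{κ₂} g κ₂ x₂·(Σ_{y∈T} gaugeWt N y κ₂ x₂) = Σ_{y∈T} Σ_{v∈box} Σ_κ (g κ (N•y + v − e_κ) − g κ (N•y + v))`. -/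
theorem sum_read_gaugeWt_eq_boxSum (hN : 1 ≤ N) (g : Fin (d + 1) → Site (d + 1) → ℝ) (T : Finset (Site (d + 1))) :
    ∑' x₂, ∑ κ₂, g κ₂ x₂ * ∑ y ∈ T, gaugeWt N y κ₂ x₂ =
      ∑ y ∈ T, ∑ v ∈ box (d + 1) N, ∑ κ, (g κ ((N : ℤ) • y + toSite v - unitVec κ) - g κ ((N : ℤ) • y + toSite v)) := by
  rw [← sum_read_gaugeWt hN g T]
  exact Finset.sum_congr rfl fun y _ => tsum_mul_gaugeWt_eq_boxSum hN g y

/-- [folklore] … and in FACE FORM (leaf-03's `BlockDivergenceFlux.boxSum_sub_shift_eq_faces` BY NAME): the response read with the union weight is, label by label and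
direction by direction, the ENTERING-face sum minus the EXITING-face sum of `g` — the UNSUMMED DIFFERENCE FORM of the response letter (the OWNER gan24-p1 g25's RULING
R-gan24p1-g25-2 (2): layer letters are handed to (LT) as face sums of differences of one bounded family; the `ω`-envelope of §1∕§5 is the corollary, not the interface). -/
theorem sum_read_gaugeWt_eq_faceSum (hN : 1 ≤ N) (g : Fin (d + 1) → Site (d + 1) → ℝ) (T : Finset (Site (d + 1))) :
    ∑' x₂, ∑ κ₂, g κ₂ x₂ * ∑ y ∈ T, gaugeWt N y κ₂ x₂
      = ∑ y ∈ T, ∑ κ, (∑ v ∈ (box (d + 1) N).filter (fun v => v κ = 0), g κ ((N : ℤ) • y + toSite v - unitVec κ)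
          - ∑ v ∈ (box (d + 1) N).filter (fun v => v κ = N - 1), g κ ((N : ℤ) • y + toSite v)) := by
  rw [sum_read_gaugeWt_eq_boxSum hN g T]
  refine Finset.sum_congr rfl fun y _ => ?_
  rw [Finset.sum_comm]
  exact Finset.sum_congr rfl fun κ _ => boxSum_sub_shift_eq_faces hN (g κ) y κ

/-- [folklore] **WEIGHTED SUPERPOSITIONS ARE FINITELY ADDITIVE IN THE WEIGHT** (entrywise summability of each term): `wsum (Σ_{y∈T} w y) K = Σ_{y∈T} wsum (w y) K`. -/
theorem wsum_finset_sum_weight {D : ℕ} {F : Type*} {ι : Type*} (T : Finset ι) {w : ι → (Fin D → ℤ) → ℝ} {K : (Fin D → ℤ) → MKer D F}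
    (h : ∀ y ∈ T, ∀ x z a b, Summable fun u => w y u * K u x z a b) :
    wsum (fun u => ∑ y ∈ T, w y u) K = ∑ y ∈ T, wsum (w y) K := by
  funext x z a b
  simp only [OneStepResolventKernel.wsum, Finset.sum_apply, Finset.sum_mul]
  exact Summable.tsum_finsetSum fun y hy => h y hy x z a b

/-- [folklore] The extension by zero `onLat` is additive over a finset of coarse weight families. -/
theorem onLat_finset_sum {ι : Type*} (T : Finset ι) (N : ℕ) (w : ι → Site (d + 1) → ℝ) :
    onLat N (fun w' => ∑ y ∈ T, w y w') = fun v => ∑ y ∈ T, onLat N (w y) v := by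
  funext v
  by_cases hv : Torus.proj N v = 0
  · simp only [InterLevelTransport.onLat, hv, if_true]
  · simp only [InterLevelTransport.onLat, hv, if_false, Finset.sum_const_zero]

/-- [folklore] **COARSE SUPERPOSITIONS ARE FINITELY ADDITIVE IN THE WEIGHT** (summability of each fine series `v ↦ onLat N (w y) v · onLat N Q v x z a b`, e.g. by
`StencilSlotLamDrift.summable_cwsumTerm`): `cwsum N (Σ_{y∈T} w y) Q = Σ_{y∈T} cwsum N (w y) Q`. -/
theorem cwsum_finset_sum_weight {ι : Type*} (T : Finset ι) {N : ℕ} {w : ι → Site (d + 1) → ℝ} {Q : Site (d + 1) → MKer (d + 1) (Fib d)}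
    (h : ∀ y ∈ T, ∀ x z a b, Summable fun v => onLat N (w y) v * onLat N Q v x z a b) :
    cwsum N (fun w' => ∑ y ∈ T, w y w') Q = ∑ y ∈ T, cwsum N (w y) Q := by
  unfold InterLevelTransport.cwsum
  rw [onLat_finset_sum T N w]
  exact wsum_finset_sum_weight T h

variable [NeZero N]

/-- [folklore] **THE RESPONSE PIECE SUMMED OVER LABELS — `Σ_{y∈T} 𝒢[A](ĝ_y) = 𝒢[A](ĝ_T)`** in an1's literal `wsum`/`cwsum` shape: for `A` bi-localised at `(p, q)`
(rate `δ > 0`), localised tables `S`, `M` (the hypotheses of `KernelWardResidual.biLoc_gaugeSup`) and `1 ≤ N`, for every finset `T` of labels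
`Σ_{y∈T} (Σ_κ wsum (u ↦ Σ'Σ A u x₂ (inl κ)(inl κ₂)·gaugeWt N y κ₂ x₂) (S κ) + Σ_ρ cwsum N (w ↦ Σ'Σ A (N•w) x₂ (inr ρ)(inl κ₂)·gaugeWt N y κ₂ x₂) (M ρ))`
`= Σ_κ wsum (u ↦ Σ'Σ A u x₂ (inl κ)(inl κ₂)·ĝ_T κ₂ x₂) (S κ) + Σ_ρ cwsum N (w ↦ Σ'Σ A (N•w) x₂ (inr ρ)(inl κ₂)·ĝ_T κ₂ x₂) (M ρ)`, `ĝ_T = Σ_{y∈T} gaugeWt N y`.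
With `A := G_j ∘ dM G_j Lc S_j M_j ν y′` this is the response summand `𝒢_j(∇1_{T-fine}) = Σ_{y∈T} 𝒢_j(y)` of design §2 (P2) `Ψ_j^T`. -/
theorem sum_gaugeSup {A : MKer (d + 1) (Fib d)} {p q : Site (d + 1)} {C δ : ℝ} (hA : BiLoc A p q C δ) (hδ : 0 < δ) (hN : 1 ≤ N)
    {S : Fin (d + 1) → Site (d + 1) → MKer (d + 1) (Fib d)} {Cs : ℝ} (hS : LocStencil S Cs δ)
    {M : Fin (d + 1) → Site (d + 1) → MKer (d + 1) (Fib d)} {CM : ℝ} (hM : VertexFamily M N CM δ) (T : Finset (Site (d + 1))) :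
    ∑ y ∈ T, (∑ κ, wsum (fun u => ∑' x₂, ∑ κ₂, A u x₂ (Sum.inl κ) (Sum.inl κ₂) * gaugeWt N y κ₂ x₂) (S κ)
        + ∑ ρ, cwsum N (fun w => ∑' x₂, ∑ κ₂, A ((N : ℤ) • w) x₂ (Sum.inr ρ) (Sum.inl κ₂) * gaugeWt N y κ₂ x₂) (M ρ))
      = ∑ κ, wsum (fun u => ∑' x₂, ∑ κ₂, A u x₂ (Sum.inl κ) (Sum.inl κ₂) * ∑ y ∈ T, gaugeWt N y κ₂ x₂) (S κ)
        + ∑ ρ, cwsum N (fun w => ∑' x₂, ∑ κ₂, A ((N : ℤ) • w) x₂ (Sum.inr ρ) (Sum.inl κ₂) * ∑ y ∈ T, gaugeWt N y κ₂ x₂) (M ρ) := by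
  have hC : 0 ≤ C := hA.nonneg (Sum.inl 0)
  have hC' : 0 ≤ (d + 1 : ℕ) * C * Zl (d + 1) δ := by
    have := Zl_nonneg (D := d + 1) hδ
    positivity
  -- summability of every single-label term (an1's decaying weight bound × the tables' self-localisation)
  have hsumS : ∀ (κ : Fin (d + 1)), ∀ y ∈ T, ∀ x z a b, Summable fun u =>
      (∑' x₂, ∑ κ₂, A u x₂ (Sum.inl κ) (Sum.inl κ₂) * gaugeWt N y κ₂ x₂) * S κ u x z a b := fun κ y _ x z a b =>
    summable_wsumTerm (fun u => abs_read_le hA hδ (fun κ₂ x₂ => KernelWardResidual.abs_gaugeWt_le_one N y κ₂ x₂) u (Sum.inl κ))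
      (fun u => hS κ u) hδ hC' x z a b
  have hsumM : ∀ (ρ : Fin (d + 1)), ∀ y ∈ T, ∀ x z a b, Summable fun v =>
      onLat N (fun w => ∑' x₂, ∑ κ₂, A ((N : ℤ) • w) x₂ (Sum.inr ρ) (Sum.inl κ₂) * gaugeWt N y κ₂ x₂) v * onLat N (M ρ) v x z a b :=
    fun ρ y _ x z a b =>
    summable_wsumTerm
      (onLat_weight_bound (fun w => abs_read_le hA hδ (fun κ₂ x₂ => KernelWardResidual.abs_gaugeWt_le_one N y κ₂ x₂) ((N : ℤ) • w) (Sum.inr ρ)) hC')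
      (onLat_biLoc (fun w => hM ρ w)) hδ hC' x z a b
  -- the weights add up label by label (§3–§4)
  have eS : ∀ κ : Fin (d + 1), (fun u => ∑ y ∈ T, ∑' x₂, ∑ κ₂, A u x₂ (Sum.inl κ) (Sum.inl κ₂) * gaugeWt N y κ₂ x₂) =
      fun u => ∑' x₂, ∑ κ₂, A u x₂ (Sum.inl κ) (Sum.inl κ₂) * ∑ y ∈ T, gaugeWt N y κ₂ x₂ := fun κ =>
    funext fun u => sum_read_gaugeWt hN (fun κ₂ x₂ => A u x₂ (Sum.inl κ) (Sum.inl κ₂)) T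
  have eM : ∀ ρ : Fin (d + 1), (fun w => ∑ y ∈ T, ∑' x₂, ∑ κ₂, A ((N : ℤ) • w) x₂ (Sum.inr ρ) (Sum.inl κ₂) * gaugeWt N y κ₂ x₂) =
      fun w => ∑' x₂, ∑ κ₂, A ((N : ℤ) • w) x₂ (Sum.inr ρ) (Sum.inl κ₂) * ∑ y ∈ T, gaugeWt N y κ₂ x₂ := fun ρ =>
    funext fun w => sum_read_gaugeWt hN (fun κ₂ x₂ => A ((N : ℤ) • w) x₂ (Sum.inr ρ) (Sum.inl κ₂)) T
  rw [Finset.sum_add_distrib, Finset.sum_comm, Finset.sum_comm (s := T)]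
  congr 1
  · refine Finset.sum_congr rfl fun κ _ => ?_
    rw [← eS κ, wsum_finset_sum_weight T (hsumS κ)]
  · refine Finset.sum_congr rfl fun ρ _ => ?_
    rw [← eM ρ, cwsum_finset_sum_weight T (hsumM ρ)]

end LabelSums

/-! ## §5 The response piece with the union weight: the single-label class, every `T` (K-LL-2 does not fire); the layer envelope -/
section UnionClass

variable {N : ℕ} [NeZero N]

/-- [folklore] **`𝒢[A](ĝ_T)` HAS THE SINGLE-LABEL CLASS, FOR EVERY FINITE LABEL SET `T`** — design §5 Q3 at the typed level: the response piece paired with the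
indicator gradient of ANY finite union of blocks is bi-localised at `(p, p)` with EXACTLY the constant and rate of an1's `KernelWardResidual.biLoc_gaugeSup` (one
label), because only `sup |ĝ_T| ≤ 1` (§3) enters §2 — never the mass `Σ|ĝ_T| ∝ |∂(T-fine)|`.  K-LL-2 does not fire. -/
theorem biLoc_gaugeSup_sum {A : MKer (d + 1) (Fib d)} {p q : Site (d + 1)} {C δ : ℝ} (hA : BiLoc A p q C δ) (hδ : 0 < δ)
    {S : Fin (d + 1) → Site (d + 1) → MKer (d + 1) (Fib d)} {Cs : ℝ} (hS : LocStencil S Cs δ)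
    {M : Fin (d + 1) → Site (d + 1) → MKer (d + 1) (Fib d)} {CM : ℝ} (hM : VertexFamily M N CM δ) (T : Finset (Site (d + 1))) :
    BiLoc (∑ κ, wsum (fun u => ∑' x₂, ∑ κ₂, A u x₂ (Sum.inl κ) (Sum.inl κ₂) * ∑ y ∈ T, gaugeWt N y κ₂ x₂) (S κ)
        + ∑ ρ, cwsum N (fun w => ∑' x₂, ∑ κ₂, A ((N : ℤ) • w) x₂ (Sum.inr ρ) (Sum.inl κ₂) * ∑ y ∈ T, gaugeWt N y κ₂ x₂) (M ρ)) p p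
      ((d + 1 : ℕ) * ((d + 1 : ℕ) * C * Zl (d + 1) δ * Cs * Zl (d + 1) (δ / 2))
        + (d + 1 : ℕ) * ((d + 1 : ℕ) * C * Zl (d + 1) δ * CM * Zl (d + 1) (δ / 2))) (δ / 2) :=
  biLoc_sup_of_weight hA hδ (fun κ x => abs_sum_gaugeWt_le_one T N κ x) hS hM

/-- [folklore] **THE SAME PIECE SUMMED LABEL BY LABEL** (the left-hand side of `sum_gaugeSup`) has that class too (`1 ≤ N`). -/
theorem biLoc_sum_gaugeSup {A : MKer (d + 1) (Fib d)} {p q : Site (d + 1)} {C δ : ℝ} (hA : BiLoc A p q C δ) (hδ : 0 < δ) (hN : 1 ≤ N)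
    {S : Fin (d + 1) → Site (d + 1) → MKer (d + 1) (Fib d)} {Cs : ℝ} (hS : LocStencil S Cs δ)
    {M : Fin (d + 1) → Site (d + 1) → MKer (d + 1) (Fib d)} {CM : ℝ} (hM : VertexFamily M N CM δ) (T : Finset (Site (d + 1))) :
    BiLoc (∑ y ∈ T, (∑ κ, wsum (fun u => ∑' x₂, ∑ κ₂, A u x₂ (Sum.inl κ) (Sum.inl κ₂) * gaugeWt N y κ₂ x₂) (S κ)
        + ∑ ρ, cwsum N (fun w => ∑' x₂, ∑ κ₂, A ((N : ℤ) • w) x₂ (Sum.inr ρ) (Sum.inl κ₂) * gaugeWt N y κ₂ x₂) (M ρ))) p p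
      ((d + 1 : ℕ) * ((d + 1 : ℕ) * C * Zl (d + 1) δ * Cs * Zl (d + 1) (δ / 2))
        + (d + 1 : ℕ) * ((d + 1 : ℕ) * C * Zl (d + 1) δ * CM * Zl (d + 1) (δ / 2))) (δ / 2) := by
  rw [sum_gaugeSup hA hδ hN hS hM T]
  exact biLoc_gaugeSup_sum hA hδ hS hM T

/-- [folklore] **THE LAYER ENVELOPE OF THE RESPONSE PIECE**: if every bond `(x, x + e_κ)` crossing `∂(T-fine)` (i.e. every `x` with `Σ_{y∈T} gaugeWt N y κ x ≠ 0`) lies at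
l1-distance ≥ `D` from the kernel's right centre `q`, then `𝒢[A](ĝ_T)` is bi-localised at `(p, p)` with the constant of `biLoc_sup_of_support` — the single-label-type
constant at `Zl(δ/2)` TIMES `e^{−(δ/2)·D}`, rate `δ/2`: the response letter of design §3 (LAY)(b) is exponentially small in the distance from the slot to `∂(T-fine)`. -/
theorem biLoc_gaugeSup_sum_of_support {A : MKer (d + 1) (Fib d)} {p q : Site (d + 1)} {C δ : ℝ} (hA : BiLoc A p q C δ) (hδ : 0 < δ)
    {T : Finset (Site (d + 1))} {D : ℝ} (hD : ∀ κ x, ∑ y ∈ T, gaugeWt N y κ x ≠ 0 → D ≤ l1 (x - q))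
    {S : Fin (d + 1) → Site (d + 1) → MKer (d + 1) (Fib d)} {Cs : ℝ} (hS : LocStencil S Cs δ)
    {M : Fin (d + 1) → Site (d + 1) → MKer (d + 1) (Fib d)} {CM : ℝ} (hM : VertexFamily M N CM δ) :
    BiLoc (∑ κ, wsum (fun u => ∑' x₂, ∑ κ₂, A u x₂ (Sum.inl κ) (Sum.inl κ₂) * ∑ y ∈ T, gaugeWt N y κ₂ x₂) (S κ)
        + ∑ ρ, cwsum N (fun w => ∑' x₂, ∑ κ₂, A ((N : ℤ) • w) x₂ (Sum.inr ρ) (Sum.inl κ₂) * ∑ y ∈ T, gaugeWt N y κ₂ x₂) (M ρ)) p p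
      ((d + 1 : ℕ) * ((d + 1 : ℕ) * C * Zl (d + 1) (δ / 2) * Real.exp (-(δ / 2) * D) * Cs * Zl (d + 1) (δ / 2))
        + (d + 1 : ℕ) * ((d + 1 : ℕ) * C * Zl (d + 1) (δ / 2) * Real.exp (-(δ / 2) * D) * CM * Zl (d + 1) (δ / 2))) (δ / 2) :=
  biLoc_sup_of_support hA hδ (fun κ x => abs_sum_gaugeWt_le_one T N κ x) hD hS hM

end UnionClass

end Summit.QuantumFields.BalabanUV.Beta.GAN24.GaugeReadLabelSums

end
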